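import Literature.Analysis.FluidPDE.PassiveVectorVarTensorEnergyIdentity
import Literature.Analysis.FluidPDE.PassiveVectorTensorDissipationBound
import Literature.Analysis.FluidPDE.PassiveVectorTensorClass
import Literature.Analysis.FluidPDE.DissipationAnomalyProofs
import Literature.Analysis.FunctionSpaces.TorusRieszFischerParam
import HarnessLib

/-!
# The energy EQUALITY for weak passive solenoidal vectors with a constant viscosity tensor

Analysis/FluidPDE file (everything proved; no definitions, no named facts). Two results.

* `exists_weakGradient_of_lintegral_eGradNormSq_ne_top` — **spectral `L²ₜH¹ₓ` ⇒ an honest weak space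
  gradient in `L²(μ_T)`**: if `u` is jointly measurable on `(0,T) × T^d`, `u(t) ∈ L²` for a.e. `t` and
  `∫_{(0,T)} ‖∇u(t)‖²_{spectral} dt < ∞` (`Torus.eGradNormSq`), then there are fields `G c`, jointly measurable
  and in `L²(μ_T)`, with `Torus.HasWeakPartialDeriv c (u t) (G t c)` for a.e. `t` (parametrised Riesz–Fischer
  `Torus.exists_memLp_two_forall_mFourierCoeff_eq` on the coefficients `2πi k_c û(t)(k)`, and
  `Torus.hasWeakPartialDeriv_of_mFourierCoeff`; the construction of `DissipationAnomalyProofs` for Leray–Hopf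
  solutions, stated for a bare field).
* `IsWeakTensorPassiveVectorOn.ae_integral_norm_sq_eq` — **the energy EQUALITY** for EVERY weak solution of
  Frisch's constant-tensor passive-vector class `IsWeakTensorPassiveVectorOn 0 T 𝔸 b w₀ w` with
  `NearIso 𝔸 lo hi`, `lo > 0`, an essentially bounded carrier and a weakly divergence-free `L²` datum:
  for a.e. `t ∈ (0,T)`, `∫‖w(t)‖² = ∫‖w₀‖² − 2∫_{(0,t]}∫ Σ_{l,i,c,e} 𝔸_{icle} (∂_c w)_i (∂_e w)_l`, with the weak
  gradient `∂_c w = G c ∈ L²(μ_T)` of the first result (dissipation finite by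
  `PassiveVectorTensorDissipationBound.eVectorDissipation_lt_top`) — the variable-tensor energy identity
  `PassiveVectorVarTensorEnergyIdentity.ae_integral_norm_sq_eq_of_weakVar` with `𝔹 ≡ 𝔸`.
  (Lions–Magenes 1972, Chap. 3 §4.4; Temam 1984, Ch. III §1 Lemma 1.2.) Cell `ad-ideate`, K1L_D, L6 (a)
  of lead memo L14 (energy equality on coarse windows: apply to `windowSol`).

## References

* J.-L. Lions, E. Magenes, *Non-homogeneous boundary value problems and applications* I (1972), Chap. 3, §4.4. [`LionsMagenes1972`]
* R. Temam, *Navier–Stokes Equations*, 3rd ed. (1984), Ch. III §1, Lemma 1.2. [`Temam1984`]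
* L. C. Evans, *Partial Differential Equations*, 2nd ed. (2010), §5.9.2, §5.8 Thm. 8. [`Evans2010`]
-/

noncomputable section

open MeasureTheory Set Filter Function TopologicalSpace Complex UnitAddTorus
open scoped ENNReal NNReal InnerProductSpace Topology ComplexConjugate

namespace Literature.Analysis.FluidPDE

namespace Torus

variable {d : Type*} [Fintype d] [DecidableEq d]

/-! ## Spectral `L²ₜH¹ₓ` gives a weak gradient in `L²(μ_T)` -/

/-- **Spectral `L²ₜH¹ₓ` ⇒ weak space gradient in `L²(μ_T)`.** Let `u : ℝ → T^d → ℝ^d` be jointly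
measurable on `(0,T) × T^d`, with `u(t) ∈ L²` for a.e. `t ∈ (0,T)` and `∫_{(0,T)} eGradNormSq (u t) dt < ∞`.
Then there are `G c : ℝ → T^d → ℝ^d` (`c : d`), each jointly measurable and in `L²(μ_T)`, such that for
a.e. `t`, `G t c` is a weak `c`-th partial derivative of `u t` for every `c`
(parametrised Riesz–Fischer on the coefficients `2πi k_c û(t)(k)`; Evans 2010, §5.9.2 / §5.8 Thm. 8).
[cite: Evans2010, §5.9.2] -/
theorem exists_weakGradient_of_lintegral_eGradNormSq_ne_top {T : ℝ} {u : ℝ → UnitAddTorus d → EuclideanSpace ℝ d}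
    (hU : AEStronglyMeasurable (uncurry u) (((volume : Measure ℝ).restrict (Ioo 0 T)).prod volume))
    (hLp : ∀ᵐ t ∂(volume.restrict (Ioo 0 T)), MemLp (u t) 2 volume)
    (hD : ∫⁻ t in Ioo 0 T, FunctionSpaces.Torus.eGradNormSq (u t) ≠ ∞) :
    ∃ G : ℝ → d → UnitAddTorus d → EuclideanSpace ℝ d,
      (∀ c, MemLp (uncurry (G · c)) 2 (((volume : Measure ℝ).restrict (Ioo 0 T)).prod volume)) ∧
      ∀ᵐ t ∂(volume.restrict (Ioo 0 T)), ∀ c, FunctionSpaces.Torus.HasWeakPartialDeriv c (u t) (G t c) := by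
  classical
  set μ : Measure ℝ := volume.restrict (Ioo 0 T) with hμ
  -- the candidate coefficients of `∂ⱼ uᵢ`
  set cf : d → d → ℝ → (d → ℤ) → ℂ := fun i j t k =>
    (2 * Real.pi * Complex.I * (k j) : ℂ) * mFourierCoeff (fun x => (u t x i : ℂ)) k with hcf
  have hc : ∀ i j k, AEStronglyMeasurable (fun t => cf i j t k) μ := fun i j k =>
    aestronglyMeasurable_const.mul (aestronglyMeasurable_mFourierCoeff_slice hU i k)
  have hC : ∀ i j, ∫⁻ t, ∑' k, ‖cf i j t k‖ₑ ^ 2 ∂μ ≠ ∞ := by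
    intro i j
    refine ne_top_of_le_ne_top hD ?_
    refine lintegral_mono_ae (hLp.mono fun t ht => ?_)
    exact tsum_enorm_sq_freq_mul_mFourierCoeff_le (ht.integrable one_le_two) i j
  -- Riesz–Fischer with the parameter `t`
  choose g hgm hg using fun i j => FunctionSpaces.Torus.exists_memLp_two_forall_mFourierCoeff_eq (hc i j) (hC i j)
  -- the gradient fields `G t j x = ∑ᵢ Re (g i j t x) eᵢ`
  refine ⟨fun t j x => ∑ i, (g i j t x).re • EuclideanSpace.single i (1 : ℝ), fun j => ?_, ?_⟩
  · -- `L²(μ_T)` membership of `G · j`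
    have hmeas : AEStronglyMeasurable (uncurry fun t x => ∑ i, (g i j t x).re • EuclideanSpace.single i (1 : ℝ))
        (μ.prod volume) := by
      have e : (uncurry fun t x => ∑ i, (g i j t x).re • EuclideanSpace.single i (1 : ℝ)) =
          fun p => ∑ i, (uncurry (g i j) p).re • EuclideanSpace.single i (1 : ℝ) := by
        funext p; rfl
      rw [e]
      exact Finset.aestronglyMeasurable_fun_sum _ fun i _ =>
        (Complex.continuous_re.comp_aestronglyMeasurable (hgm i j)).smul_const _
    refine ⟨hmeas, ?_⟩
    rw [eLpNorm_lt_top_iff_lintegral_rpow_enorm_lt_top two_ne_zero ENNReal.ofNat_ne_top, ENNReal.toReal_ofNat]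
    have e2 : ∫⁻ p, ‖(uncurry fun t x => ∑ i, (g i j t x).re • EuclideanSpace.single i (1 : ℝ)) p‖ₑ ^ (2 : ℝ) ∂(μ.prod volume) =
        ∫⁻ p, ‖(uncurry fun t x => ∑ i, (g i j t x).re • EuclideanSpace.single i (1 : ℝ)) p‖ₑ ^ 2 ∂(μ.prod volume) :=
      lintegral_congr fun p => by rw [ENNReal.rpow_two]
    rw [e2, lintegral_prod _ (hmeas.enorm.pow_const 2)]
    -- slice-wise: `∫ ‖G t j‖² ≤ ∫ Σᵢⱼ ‖g i j t‖² = eGradNormSq (u t)`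
    have hg' : ∀ᵐ t ∂μ, ∀ i j, MemLp (g i j t) 2 volume ∧ ∀ k, mFourierCoeff (g i j t) k = cf i j t k :=
      ae_all_iff.2 fun i => ae_all_iff.2 fun j => hg i j
    have hslice : ∀ᵐ t ∂μ, ∫⁻ x, ‖(uncurry fun t x => ∑ i, (g i j t x).re • EuclideanSpace.single i (1 : ℝ)) (t, x)‖ₑ ^ 2 ≤
        FunctionSpaces.Torus.eGradNormSq (u t) := by
      filter_upwards [hLp, hg'] with t hut hgt
      have hcoeff : ∀ i j (k : d → ℤ), mFourierCoeff (g i j t) k =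
          (2 * Real.pi * Complex.I * (k j) : ℂ) * mFourierCoeff (fun x => (u t x i : ℂ)) k :=
        fun i j k => (hgt i j).2 k
      rw [← FunctionSpaces.Torus.lintegral_sum_enorm_sq_eq_eGradNormSq hut (fun i j => (hgt i j).1) hcoeff]
      refine lintegral_mono fun x => ?_
      dsimp only [Function.uncurry_apply_pair]
      rw [← ofReal_norm, ← ENNReal.ofReal_pow (norm_nonneg _), norm_sq_sum_smul_single]
      calc ENNReal.ofReal (∑ i, (g i j t x).re ^ 2) ≤ ENNReal.ofReal (∑ i, ‖g i j t x‖ ^ 2) := by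
            refine ENNReal.ofReal_le_ofReal (Finset.sum_le_sum fun i _ => ?_)
            calc (g i j t x).re ^ 2 = |(g i j t x).re| ^ 2 := (sq_abs _).symm
              _ ≤ ‖g i j t x‖ ^ 2 := pow_le_pow_left₀ (abs_nonneg _) (Complex.abs_re_le_norm _) 2
        _ = ∑ i, ‖g i j t x‖ₑ ^ 2 := by
            rw [ENNReal.ofReal_sum_of_nonneg fun i _ => sq_nonneg _]
            refine Finset.sum_congr rfl fun i _ => ?_
            rw [← ofReal_norm, ENNReal.ofReal_pow (norm_nonneg _)]
        _ ≤ ∑ i, ∑ j', ‖g i j' t x‖ₑ ^ 2 :=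
            Finset.sum_le_sum fun i _ => Finset.single_le_sum (f := fun j' => ‖g i j' t x‖ₑ ^ 2) (fun _ _ => by positivity)
              (Finset.mem_univ j)
    calc ∫⁻ t, ∫⁻ x, ‖(uncurry fun t x => ∑ i, (g i j t x).re • EuclideanSpace.single i (1 : ℝ)) (t, x)‖ₑ ^ 2 ∂volume ∂μ
        ≤ ∫⁻ t, FunctionSpaces.Torus.eGradNormSq (u t) ∂μ := lintegral_mono_ae hslice
      _ < ⊤ := lt_top_iff_ne_top.2 hD
  · -- the weak derivatives, slice-wise
    have hg' : ∀ᵐ t ∂μ, ∀ i j, MemLp (g i j t) 2 volume ∧ ∀ k, mFourierCoeff (g i j t) k = cf i j t k :=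
      ae_all_iff.2 fun i => ae_all_iff.2 fun j => hg i j
    filter_upwards [hLp, hg'] with t hut hgt
    intro j
    have hcoeff : ∀ i (k : d → ℤ), mFourierCoeff (g i j t) k =
        (2 * Real.pi * Complex.I * (k j) : ℂ) * mFourierCoeff (fun x => (u t x i : ℂ)) k :=
      fun i k => (hgt i j).2 k
    exact FunctionSpaces.Torus.hasWeakPartialDeriv_of_mFourierCoeff hut (fun i => (hgt i j).1) j hcoeff

/-! ## The energy equality for the constant-tensor class -/

section Energy

variable {T : ℝ} {𝔸 : Visc4 d} {b w : ℝ → UnitAddTorus d → EuclideanSpace ℝ d} {w₀ : UnitAddTorus d → EuclideanSpace ℝ d}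

omit [DecidableEq d] in
/-- Single entries are dominated by the sum of all absolute entries. [folklore] -/
private theorem abs_entry_le_sum_V9 (𝔸 : Visc4 d) (i c j e : d) :
    |𝔸 i c j e| ≤ ∑ i', ∑ c', ∑ j', ∑ e', |𝔸 i' c' j' e'| := by
  calc |𝔸 i c j e| ≤ ∑ e', |𝔸 i c j e'| :=
        Finset.single_le_sum (f := fun e' => |𝔸 i c j e'|) (fun _ _ => abs_nonneg _) (Finset.mem_univ e)
    _ ≤ ∑ j', ∑ e', |𝔸 i c j' e'| :=
        Finset.single_le_sum (f := fun j' => ∑ e', |𝔸 i c j' e'|) (fun _ _ => by positivity) (Finset.mem_univ j)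
    _ ≤ ∑ c', ∑ j', ∑ e', |𝔸 i c' j' e'| :=
        Finset.single_le_sum (f := fun c' => ∑ j', ∑ e', |𝔸 i c' j' e'|) (fun _ _ => by positivity) (Finset.mem_univ c)
    _ ≤ ∑ i', ∑ c', ∑ j', ∑ e', |𝔸 i' c' j' e'| :=
        Finset.single_le_sum (f := fun i' => ∑ c', ∑ j', ∑ e', |𝔸 i' c' j' e'|) (fun _ _ => by positivity) (Finset.mem_univ i)

set_option maxHeartbeats 800000 in
/-- **The energy EQUALITY for weak passive solenoidal vectors with a constant viscosity tensor.** For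
`T > 0`, `NearIso 𝔸 lo hi` with `lo > 0`, a carrier `b ∈ L^∞((0,T) × T^d)` (space–time lift) with
essential bound `M` and a weakly divergence-free datum `w₀ ∈ L²`, EVERY weak solution
`w ∈ IsWeakTensorPassiveVectorOn 0 T 𝔸 b w₀` carries a weak space gradient `G c = ∂_c w ∈ L²(μ_T)` and
satisfies, for a.e. `t ∈ (0,T)`, the energy equality
`∫‖w(t)‖² = ∫‖w₀‖² − 2 ∫_{(0,t]} ∫ Σ_{l,i,c,e} 𝔸_{icle} (G τ c x)_i (G τ e x)_l dx dτ`
(the class dissipates exactly; Lions–Magenes 1972, Chap. 3 §4.4 / Temam 1984, Ch. III Lemma 1.2, through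
the variable-tensor energy identity with `𝔹 ≡ 𝔸`). [cite: LionsMagenes1972, Chap. 3 §4.4] [cite: Temam1984, Ch. III §1 Lemma 1.2] -/
theorem IsWeakTensorPassiveVectorOn.ae_integral_norm_sq_eq (h : IsWeakTensorPassiveVectorOn 0 T 𝔸 b w₀ w)
    {lo hi : ℝ} (h𝔸 : NearIso 𝔸 lo hi) (hlo : 0 < lo)
    (hb : MemLp (FunctionSpaces.Torus.stLift b) ∞ (volume.restrict (Ioo 0 T ×ˢ univ)))
    {M : ℝ} (hM : 0 ≤ M)
    (hbM : ∀ᵐ p ∂(((volume : Measure ℝ).restrict (Ioo 0 T)).prod (volume : Measure (UnitAddTorus d))),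
      ‖uncurry b p‖ ≤ M)
    (hw₀ : MemLp w₀ 2 volume) (hdiv₀ : FunctionSpaces.Torus.IsWeaklyDivFree w₀) :
    ∃ G : ℝ → d → UnitAddTorus d → EuclideanSpace ℝ d,
      (∀ c, MemLp (uncurry (G · c)) 2 (((volume : Measure ℝ).restrict (Ioo 0 T)).prod volume)) ∧
      (∀ᵐ t ∂(volume.restrict (Ioo 0 T)), ∀ c, FunctionSpaces.Torus.HasWeakPartialDeriv c (w t) (G t c)) ∧
      ∀ᵐ t ∂(volume.restrict (Ioo 0 T)),
        ∫ x, ‖w t x‖ ^ 2 = (∫ x, ‖w₀ x‖ ^ 2) -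
          2 * ∫ τ in Ioc 0 t, ∫ x, ∑ l, ∑ i, ∑ c, ∑ e, 𝔸 i c l e * (G τ c x) i * (G τ e x) l := by
  have hwm := h.aestronglyMeasurable_uncurry
  have hw2s := h.ae_memLp_two
  -- spectral dissipation is finite, hence a weak gradient in `L²(μ_T)`
  have hDfin : ∫⁻ t in Ioo 0 T, FunctionSpaces.Torus.eGradNormSq (w t) ≠ ∞ := by
    have hE := eVectorDissipation_lt_top h h𝔸 hlo hw₀ hdiv₀ hb
    unfold eVectorDissipation at hE
    have hlo' : ENNReal.ofReal lo ≠ 0 := by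
      rw [ne_eq, ENNReal.ofReal_eq_zero, not_le]
      exact hlo
    intro htop
    rw [htop, ENNReal.mul_top hlo'] at hE
    exact lt_irrefl _ hE
  obtain ⟨G, hG2, hGw⟩ := exists_weakGradient_of_lintegral_eGradNormSq_ne_top hwm hw2s hDfin
  -- the class member is in `L²(μ_T)`
  have hw2 : MemLp (uncurry w) 2 (((volume : Measure ℝ).restrict (Ioo 0 T)).prod volume) := by
    obtain ⟨C, hC⟩ := h.ae_lintegral_sq_le
    refine ⟨hwm, ?_⟩
    rw [eLpNorm_lt_top_iff_lintegral_rpow_enorm_lt_top two_ne_zero ENNReal.ofNat_ne_top, ENNReal.toReal_ofNat]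
    have e : ∫⁻ p, ‖uncurry w p‖ₑ ^ (2 : ℝ) ∂(((volume : Measure ℝ).restrict (Ioo 0 T)).prod volume) =
        ∫⁻ p, ‖uncurry w p‖ₑ ^ 2 ∂(((volume : Measure ℝ).restrict (Ioo 0 T)).prod volume) :=
      lintegral_congr fun p => by rw [ENNReal.rpow_two]
    rw [e, lintegral_prod _ (hwm.enorm.pow_const 2)]
    calc ∫⁻ t in Ioo 0 T, ∫⁻ x, ‖uncurry w (t, x)‖ₑ ^ 2
        ≤ ∫⁻ _ in Ioo 0 T, (C : ℝ≥0∞) := lintegral_mono_ae (hC.mono fun t ht => ht)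
      _ < ⊤ := by
          rw [lintegral_const, Measure.restrict_apply_univ]
          exact ENNReal.mul_lt_top ENNReal.coe_lt_top measure_Ioo_lt_top
  -- the weak formulation in product form, written with `viscAdjVar (fun _ => 𝔸)`
  have hweak : ∀ Ψ : ℝ → UnitAddTorus d → EuclideanSpace ℝ d, FunctionSpaces.Torus.IsSpaceTimeTest T Ψ →
      (∀ t, FunctionSpaces.Torus.IsDivFree (Ψ t)) →
      (∫ p, ⟪w p.1 p.2, FunctionSpaces.Torus.timeDeriv Ψ p.1 p.2 +
          FunctionSpaces.Torus.convect (b p.1) (Ψ p.1) p.2 +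
            viscAdjVar ((fun (_ : ℝ) (_ : UnitAddTorus d) => 𝔸) p.1) (Ψ p.1) p.2⟫_ℝ
          ∂(((volume : Measure ℝ).restrict (Ioo 0 T)).prod volume)) + ∫ x, ⟪w₀ x, Ψ 0 x⟫_ℝ = 0 := by
    intro Ψ hΨ hΨdiv
    have key := h.weak_eq Ψ hΨ hΨdiv
    have hint := h.integrable_weakIntegrand hΨ
    simp only [zero_mul, add_zero] at key hint
    have e : ∀ p : ℝ × UnitAddTorus d, viscAdjVar ((fun (_ : ℝ) (_ : UnitAddTorus d) => 𝔸) p.1) (Ψ p.1) p.2 =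
        viscAdj 𝔸 (Ψ p.1) p.2 := fun p => viscAdjVar_const 𝔸 (hΨ.isSmooth_slice p.1) p.2
    simp_rw [e]
    rw [integral_prod _ hint]
    exact key
  -- constant coefficient field: smooth slices, continuity, bound
  have h𝔹s : ∀ (t : ℝ) i c j e, FunctionSpaces.Torus.IsSmooth (fun y : UnitAddTorus d =>
      (fun (_ : ℝ) (_ : UnitAddTorus d) => 𝔸) t y i c j e) := fun _ _ _ _ _ => FunctionSpaces.Torus.isSmooth_const _
  have h𝔹c : ∀ i c j e, Continuous (uncurry fun (t : ℝ) (y : UnitAddTorus d) =>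
      (fun (_ : ℝ) (_ : UnitAddTorus d) => 𝔸) t y i c j e) := fun _ _ _ _ => continuous_const
  have h𝔹d : ∀ i c j e e', Continuous (uncurry fun (t : ℝ) (y : UnitAddTorus d) =>
      FunctionSpaces.Torus.partialDeriv e' (fun y => (fun (_ : ℝ) (_ : UnitAddTorus d) => 𝔸) t y i c j e) y) := by
    intro i c j e e'
    have e0 : (uncurry fun (t : ℝ) (y : UnitAddTorus d) =>
        FunctionSpaces.Torus.partialDeriv e' (fun y => (fun (_ : ℝ) (_ : UnitAddTorus d) => 𝔸) t y i c j e) y) = fun _ => 0 := by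
      funext p
      simp [Function.uncurry, FunctionSpaces.Torus.partialDeriv, FunctionSpaces.Torus.lineDeriv]
    rw [e0]
    exact continuous_const
  set B : ℝ := ∑ i, ∑ c, ∑ j, ∑ e, |𝔸 i c j e| with hBdef
  have hB0 : 0 ≤ B := by positivity
  have hB : ∀ (t : ℝ) (y : UnitAddTorus d) i c j e, |(fun (_ : ℝ) (_ : UnitAddTorus d) => 𝔸) t y i c j e| ≤ B :=
    fun _ _ i c j e => abs_entry_le_sum_V9 𝔸 i c j e
  have hbm : AEStronglyMeasurable (uncurry b) (((volume : Measure ℝ).restrict (Ioo 0 T)).prod volume) :=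
    h.aestronglyMeasurable_uncurry_carrier
  have hE := ae_integral_norm_sq_eq_of_weakVar (𝔹 := fun (_ : ℝ) (_ : UnitAddTorus d) => 𝔸) h𝔹s h𝔹c h𝔹d hB0 hB
    hw2 hw2s h.ae_isWeaklyDivFree hGw hG2 hbm hM hbM h.ae_isWeaklyDivFree_carrier hweak hw₀ hdiv₀
  exact ⟨G, hG2, hGw, hE⟩

end Energy

end Torus

end Literature.Analysis.FluidPDE

end
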